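import Mathlib.RingTheory.Ideal.Maps
import Mathlib.RingTheory.Ideal.Operations
import HarnessLib

/-!
# The assembly step of Proposition V58: supported ideals from the key identity (cell `b2b-bsdres`, seat additive-p4 gen 37, line V58/V64 — step (iv))

HONEST FRAMING (verbatim, cell `b2b-bsdres`): the goal of the cell is to DELETE the COMBINATION-SHAPED
residual classes for ALL analytic-rank `≤ 1` curves over `ℚ` — "full BSD formula for every rank `≤ 1`
curve in class `C`" assembled STRICTLY from published theorems — so that the rank-`≤ 1` remainder
becomes exactly the CONSTRUCTION-SHAPED classes, which are TYPED (missing-input Props), NOT attempted;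
this is not "finishing BSD". This file: TOOL theorem (pure ring algebra; 0 defs, 0 facts, nothing
booked; X4 stays CONSTRUCTION-SHAPED; no mark moves).

## Why

In memo V58 (§2–§4; re-used by memo V62 D7 and memo V64 Prop. V64-D) the two-prime saturation T-V54 at
a multiplicity-one maximal ideal is the ring identity (R) `A_{oo∪Z∪W} = A_{oo∪Z} + A_{oo∪W}` for the
SUPPORTED IDEALS `A_S = {t : t vanishes on every newform-type outside S}` of the local Hecke algebra
`𝕋′ ⊂ ∏_c K_c`, the types w.r.t. the two primes being `oo` (old at both), `Z` (new at `ℓ₂` only),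
`W` (new at `ℓ₁` only), `W′` (new at both). Step (iv) of V58 derives (R) from the KEY IDENTITY (K) on
the `ℓ₂`-new quotient (Brandt module / σ(θ)-forms; Lemma L1 = `X4/OldSupportFactorsThroughDegeneracy`,
L2 = K104) and Ribet's `σδ = η` (E): together they say that for every `t` killing `W′` there is an
`x ∈ 𝕋′` agreeing with `t` on `Z` and vanishing on `W` and `W′`. This file proves that this combined
statement implies (R) — the bookkeeping `t = x + (t − x)` — with the four type-components modelled
as ring homomorphisms `e_c : T → R_c`:

* `ker_le_sup_of_keyIdentity` : if every `t ∈ ker e₄` admits `x` with `e₂ x = e₂ t`, `e₃ x = 0`,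
  `e₄ x = 0`, then `ker e₄ ≤ (ker e₃ ⊓ ker e₄) ⊔ (ker e₂ ⊓ ker e₄)`, i.e.
  `A_{oo∪Z∪W} ≤ A_{oo∪Z} + A_{oo∪W}` (the reverse inclusion is trivial: `sup_inf_ker_le_ker`).

No number theory enters; (K), (E) and the multiplicity-one translation (i) are the APPLICATION's inputs.

## References (context only)

* K. Ribet, Invent. Math. 100 (1990), §3, (6.1) (`σδ = η`). [cite: Ribet1990, §3, (6.1)]
* H. Darmon, F. Diamond, R. Taylor, Fermat's last theorem (1995), Lemma 4.28. [cite: DarmonDiamondTaylor1995, Lemma 4.28]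
-/

namespace Summit.BirchSwinnertonDyer.Rank1Residual.LevelLowering

section Assembly

variable {T R₂ R₃ R₄ : Type*} [CommRing T] [CommRing R₂] [CommRing R₃] [CommRing R₄]

/-- **V58 step (iv): (K)+(E) ⟹ (R).** With the type-components `e₂` (`Z`), `e₃` (`W`), `e₄` (`W′`)
of the local Hecke algebra `T` (the `oo`-component plays no role): if every `t` killing `W′` admits
`x ∈ T` with the same `Z`-component and vanishing `W`, `W′`-components, then
`A_{oo∪Z∪W} = ker e₄ ≤ (ker e₃ ⊓ ker e₄) ⊔ (ker e₂ ⊓ ker e₄) = A_{oo∪Z} + A_{oo∪W}`.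
[cite: Ribet1990, §3, (6.1)] -/
theorem ker_le_sup_of_keyIdentity (e₂ : T →+* R₂) (e₃ : T →+* R₃) (e₄ : T →+* R₄)
    (hKE : ∀ t : T, e₄ t = 0 → ∃ x : T, e₂ x = e₂ t ∧ e₃ x = 0 ∧ e₄ x = 0) :
    RingHom.ker e₄ ≤ (RingHom.ker e₃ ⊓ RingHom.ker e₄) ⊔ (RingHom.ker e₂ ⊓ RingHom.ker e₄) := by
  intro t ht
  rw [RingHom.mem_ker] at ht
  obtain ⟨x, hx2, hx3, hx4⟩ := hKE t ht
  have e : t = x + (t - x) := by ring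
  rw [e]
  refine Submodule.add_mem_sup ?_ ?_
  · exact ⟨by simpa [RingHom.mem_ker] using hx3, by simpa [RingHom.mem_ker] using hx4⟩
  · have h2 : t - x ∈ RingHom.ker e₂ := by rw [RingHom.mem_ker, map_sub, hx2, sub_self]
    have h4 : t - x ∈ RingHom.ker e₄ := by rw [RingHom.mem_ker, map_sub, ht, hx4, sub_self]
    exact ⟨h2, h4⟩

/-- The trivial inclusion `A_{oo∪Z} + A_{oo∪W} ≤ A_{oo∪Z∪W}`. -/
theorem sup_inf_ker_le_ker (e₂ : T →+* R₂) (e₃ : T →+* R₃) (e₄ : T →+* R₄) :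
    (RingHom.ker e₃ ⊓ RingHom.ker e₄) ⊔ (RingHom.ker e₂ ⊓ RingHom.ker e₄) ≤ RingHom.ker e₄ :=
  sup_le inf_le_right inf_le_right

/-- Hence, under (K)+(E), the supported-ideal identity (R) holds as an EQUALITY. -/
theorem ker_eq_sup_of_keyIdentity (e₂ : T →+* R₂) (e₃ : T →+* R₃) (e₄ : T →+* R₄)
    (hKE : ∀ t : T, e₄ t = 0 → ∃ x : T, e₂ x = e₂ t ∧ e₃ x = 0 ∧ e₄ x = 0) :
    RingHom.ker e₄ = (RingHom.ker e₃ ⊓ RingHom.ker e₄) ⊔ (RingHom.ker e₂ ⊓ RingHom.ker e₄) :=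
  le_antisymm (ker_le_sup_of_keyIdentity e₂ e₃ e₄ hKE) (sup_inf_ker_le_ker e₂ e₃ e₄)

end Assembly

end Summit.BirchSwinnertonDyer.Rank1Residual.LevelLowering
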